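import Literature.AnabelianGeometry.EtaleTheta.ThetaCoversHeisenbergWitnessProp22
import Literature.AnabelianGeometry.EtaleTheta.SettingModelFreeGroup
import Literature.AnabelianGeometry.SemiGraphs.TemperedAnabelian
import Mathlib.Topology.Instances.ZMod
import HarnessLib

/-!
# A MODEL of the tempered theta-covering interface `ThetaCovers.TemperedCoverData` ([EtTh] §2, Def 2.5), part 1:
# carriers, completion maps, and the profinite cover data `CoverDataAx` of the model

S. Mochizuki, *The étale theta function and its Frobenioid-theoretic manifestations*, Publ. RIMS **45** (2009)
[MochizukiEtTh2009], §2: Def. 2.1 – Prop. 2.2 (pp.35–38, PDF), Def. 2.5 (pp.39–40).  abc-iut cell, layer L2,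
L2-lead ROWS #13 (R125) → seat abc-iut-w5-d118: «NV-L2/TemperedCoverData — a MODEL (none in tree) + the
INDEPENDENCE CERTIFICATE for the cusp hypotheses of Cor. 2.9 (GAP-LEDGER G-L2d3-2)».

CONSISTENCY WITNESS / TOY — consistency ≠ faithfulness; a DEGENERATE model (`G_K = 1`), NOT the tempered
fundamental group of a curve; nothing here takes a side on anything printed.  DEF-BEARING (post-freeze
class (b) MODEL/CONSTRUCTION file: no frozen structure is touched; instances only on the NEW synonym `TA`).

THE MODEL («Heisenberg ⋊ D_l, times a Tate `ℤ ⊆ Ẑ`»).  Fix an odd `l`.  With abc-iut-w5-d243's finite Heisenberg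
toy `heisPiC l = (ℤ/l × ℤ/l) ⋊ D_l` (`ThetaCoversHeisenbergGroup/Witness*.lean`) put

* `A := heisPiC l × ℤ/2` (finite, discrete) and the DISCRETE tempered group `Π^tp_C := A × ℤ` (part 2);
* `Π_C := Â × Ẑ`, the product of Mathlib's profinite completions (`ProfiniteGrp.ProfiniteCompletion`), with
  `Π^tp_C ↪ Π_C` = `η_A × η_ℤ` — a profinite completion in the sense of abc-iut-L3's `IsProfiniteCompletion` by
  abc-iut-L2-t1's `isProfiniteCompletion_prodMap_etaCont`;
* `π_A : Â → A` (the continuous retraction extending `id_A`, `A` being finite) and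
  `π_l : Ẑ → ℤ/l` (the continuous extension of `ℤ → ℤ/l`); `Φ := pr_Heis ∘ π_A ∘ pr₁ : Π_C → heisPiC l`,
  `Ψ := π_l ∘ pr₂ : Π_C → ℤ/l`;
* `G_K := 1`; `Π_X := Φ⁻¹(heisPiX)` (index 2); `Δ̄_Θ-preimage := Φ⁻¹(heisTheta)` (so `Δ̄^ell_X =` the toy's
  `(a, b)`-plane); `Ker(Δ_X ↠ Δ̄_X) := Φ⁻¹(heisTheta) ∩ Ker Ψ` (so `Δ̄_Θ ≅ Ẑ/lẐ ≅ ℤ/l` is the TATE direction and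
  the toy's coordinate `c` is killed); `D_x := Δ̄_Θ-preimage`.

This file (DEF-BEARING): the carriers and maps, `TemperedModel.coverDataAx l : CoverDataAx l` — all 20-odd axioms
of Def. 2.1 / Rmk. 2.1.1 / Prop. 2.2 (i) hold (from the toy's, through `Φ`, `Ψ`) — and the DATA of the rest of the
model (`Π_C̲`, `ι̲`, `E`, `Π_C̲̲`, `A_X`).  Proof-only sequels: `Discharge/Sec2TemperedCoverDataModelTheta.lean`
(`Π_C̲̲` is of type `(1, l-torsΘ)±`) and `Discharge/Sec2TemperedCoverDataModel.lean` (the tempered layer, the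
INHABITANT of `TemperedCoverData l` inside `exists_model`, and the certificate: at this model `cuspStabC = Π^tp_C`,
so the cusp hypothesis `hC1` of [EtTh] Cor. 2.9 FAILS and `#cuspOrbits = 1 ≠ (l+1)/2` — GAP-LEDGER G-L2d3-2's
binders are NOT derivable from the typed interface).
[cite: MochizukiEtTh2009, Def 2.1 p.36] [cite: MochizukiEtTh2009, Def 2.5 p.39]
-/

noncomputable section

namespace Literature.AnabelianGeometry.EtaleTheta

namespace ThetaCovers

namespace TemperedModel

open Multiplicative HeisenbergWitness Literature.AnabelianGeometry.SemiGraphs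
  Literature.AnabelianGeometry.EtaleTheta.SettingModel

variable (l : ℕ)

/-! ## 1. The finite factor `A = heisPiC l × ℤ/2` and the completions -/

/-- The finite factor `A := ((ℤ/l × ℤ/l) ⋊ D_l) × ℤ/2` of the model's `Π^tp_C = A × ℤ` (a NEW type synonym, so
that it may carry the discrete topology). (toy bookkeeping; no claim about print)
[cite: MochizukiEtTh2009, Def 2.5 p.39] -/
def TA : Type := heisPiC l × Multiplicative (ZMod 2)

/-- `A` is a group (the product group). (toy bookkeeping) [cite: MochizukiEtTh2009, Def 2.5 p.39] -/
instance : Group (TA l) := inferInstanceAs (Group (heisPiC l × Multiplicative (ZMod 2)))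

/-- `A` carries the DISCRETE topology. (toy bookkeeping) [cite: MochizukiEtTh2009, Def 2.5 p.39] -/
instance : TopologicalSpace (TA l) := ⊥

/-- `A` is discrete. (toy bookkeeping) [cite: MochizukiEtTh2009, Def 2.5 p.39] -/
instance : DiscreteTopology (TA l) := ⟨rfl⟩

/-- `A` is a topological group (discrete). (toy bookkeeping) [cite: MochizukiEtTh2009, Def 2.5 p.39] -/
instance : IsTopologicalGroup (TA l) where
  continuous_mul := continuous_of_discreteTopology
  continuous_inv := continuous_of_discreteTopology

/-- `A` is finite (`l ≠ 0`). (toy bookkeeping) [cite: MochizukiEtTh2009, Def 2.5 p.39] -/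
instance [NeZero l] : Finite (TA l) := by
  haveI : Finite (heisPiC l) :=
    Finite.of_injective (fun x : heisPiC l => (x.left, x.right))
      fun x y h => SemidirectProduct.ext (Prod.mk.inj h).1 (Prod.mk.inj h).2
  exact inferInstanceAs (Finite (heisPiC l × Multiplicative (ZMod 2)))

/-- Elements of `A` from their two components. (toy bookkeeping) [cite: MochizukiEtTh2009, Def 2.5 p.39] -/
def TA.mk (h : heisPiC l) (t : Multiplicative (ZMod 2)) : TA l := (h, t)

/-- The Heisenberg component `A → heisPiC l`. (toy bookkeeping) [cite: MochizukiEtTh2009, Def 2.5 p.39] -/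
def TA.heis : TA l →* heisPiC l := MonoidHom.fst (heisPiC l) (Multiplicative (ZMod 2))

/-- The `ℤ/2` component `A → ℤ/2` (the `Ċ`/`Ÿ` double-cover coordinate). (toy bookkeeping)
[cite: MochizukiEtTh2009, Def 2.5 p.39] -/
def TA.two : TA l →* Multiplicative (ZMod 2) := MonoidHom.snd (heisPiC l) (Multiplicative (ZMod 2))

/-- `Â`, the profinite completion of the finite group `A` (≅ `A`). (toy bookkeeping) [cite: MochizukiEtTh2009, Def 2.5 p.39] -/
abbrev Ahat : Type := ProfiniteGrp.ProfiniteCompletion.completion (GrpCat.of (TA l))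

/-- `Ẑ`, the profinite completion of `ℤ` (abc-iut-L3's `SemiGraphs.ZHat`). (toy bookkeeping) [cite: MochizukiEtTh2009, Def 2.5 p.39] -/
abbrev Zhat : Type := ProfiniteGrp.ProfiniteCompletion.completion (GrpCat.of (Multiplicative ℤ))

/-- `Π_C := Â × Ẑ`, the model's profinite `Π_C`. (toy bookkeeping) [cite: MochizukiEtTh2009, Def 2.1 p.36] -/
abbrev PiCM : Type := Ahat l × Zhat

/-- `Π^tp_C := A × ℤ`, the model's (discrete) tempered group. (toy bookkeeping) [cite: MochizukiEtTh2009, Def 2.5 p.39] -/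
abbrev GtpM : Type := TA l × Multiplicative ℤ

/-- `Π^tp_C ↪ Π_C`: `η_A × η_ℤ`. (toy bookkeeping) [cite: MochizukiEtTh2009, Def 2.5 p.39] -/
def toHatM : GtpM l →ₜ* PiCM l := (etaCont (TA l)).prodMap (etaCont (Multiplicative ℤ))

variable [NeZero l]

/-- The continuous retraction `π_A : Â → A` (`π_A ∘ η_A = id`; exists since `A` is finite).
(toy bookkeeping) [cite: MochizukiEtTh2009, Def 2.5 p.39] -/
def piA : Ahat l →ₜ* TA l :=
  Classical.choose (exists_continuousMonoidHom_extend (TA l) (TA l) (MonoidHom.id (TA l)))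

/-- `π_A (η_A a) = a`. (toy bookkeeping) [cite: MochizukiEtTh2009, Def 2.5 p.39] -/
theorem piA_eta (a : TA l) : piA l (etaCont (TA l) a) = a :=
  Classical.choose_spec (exists_continuousMonoidHom_extend (TA l) (TA l) (MonoidHom.id (TA l))) a

/-- `π_A` is surjective. (toy bookkeeping) [cite: MochizukiEtTh2009, Def 2.5 p.39] -/
theorem piA_surjective : Function.Surjective (piA l) := fun a => ⟨etaCont (TA l) a, piA_eta l a⟩

/-- The continuous extension `π_l : Ẑ → ℤ/l` of `ℤ → ℤ/l`. (toy bookkeeping) [cite: MochizukiEtTh2009, Def 2.1 p.36] -/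
def piL : Zhat →ₜ* Multiplicative (ZMod l) :=
  Classical.choose (exists_continuousMonoidHom_extend (Multiplicative ℤ) (Multiplicative (ZMod l))
    (AddMonoidHom.toMultiplicative (Int.castAddHom (ZMod l))))

/-- `π_l (η_ℤ n) = n mod l`. (toy bookkeeping) [cite: MochizukiEtTh2009, Def 2.1 p.36] -/
theorem piL_eta (n : Multiplicative ℤ) :
    piL l (etaCont (Multiplicative ℤ) n) = ofAdd ((toAdd n : ℤ) : ZMod l) :=
  Classical.choose_spec (exists_continuousMonoidHom_extend (Multiplicative ℤ) (Multiplicative (ZMod l))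
    (AddMonoidHom.toMultiplicative (Int.castAddHom (ZMod l)))) n

/-- `π_l` is surjective. (toy bookkeeping) [cite: MochizukiEtTh2009, Def 2.1 p.36] -/
theorem piL_surjective : Function.Surjective (piL l) := by
  intro y
  obtain ⟨k, hk⟩ := ZMod.intCast_surjective (toAdd y)
  exact ⟨etaCont (Multiplicative ℤ) (ofAdd k), by rw [piL_eta, toAdd_ofAdd, hk, ofAdd_toAdd]⟩

/-! ## 2. The coordinates `Φ : Π_C → heisPiC l`, `Ψ : Π_C → ℤ/l` and the subgroups of Def. 2.1 -/

/-- `Φ := pr_Heis ∘ π_A ∘ pr₁ : Π_C → (ℤ/l × ℤ/l) ⋊ D_l`. (toy bookkeeping) [cite: MochizukiEtTh2009, Def 2.1 p.36] -/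
def Phi : PiCM l →* heisPiC l := (TA.heis l).comp ((piA l).toMonoidHom.comp (MonoidHom.fst _ _))

/-- `Φ (x, z) = (π_A x).1`. (toy bookkeeping) [cite: MochizukiEtTh2009, Def 2.1 p.36] -/
theorem Phi_apply (x : PiCM l) : Phi l x = (piA l x.1).1 := rfl

/-- `Ψ := π_l ∘ pr₂ : Π_C → ℤ/l` (the Tate direction mod `l`). (toy bookkeeping) [cite: MochizukiEtTh2009, Def 2.1 p.36] -/
def Psi : PiCM l →* Multiplicative (ZMod l) := (piL l).toMonoidHom.comp (MonoidHom.snd _ _)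

/-- `Φ` is surjective. (toy bookkeeping) [cite: MochizukiEtTh2009, Def 2.1 p.36] -/
theorem Phi_surjective : Function.Surjective (Phi l) := by
  intro h
  obtain ⟨x, hx⟩ := piA_surjective l (h, 1)
  exact ⟨(x, 1), by rw [Phi_apply, hx]⟩

/-- `Φ (η_A a, z) = a.1`. (toy bookkeeping) [cite: MochizukiEtTh2009, Def 2.1 p.36] -/
@[simp] theorem Phi_eta (a : TA l) (z : Zhat) : Phi l (etaCont (TA l) a, z) = a.1 := by
  rw [Phi_apply, piA_eta]

/-- `Ψ (x, η_ℤ n) = n mod l`. (toy bookkeeping) [cite: MochizukiEtTh2009, Def 2.1 p.36] -/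
@[simp] theorem Psi_eta (x : Ahat l) (n : Multiplicative ℤ) :
    Psi l (x, etaCont (Multiplicative ℤ) n) = ofAdd ((toAdd n : ℤ) : ZMod l) := by
  simp [Psi, piL_eta]

/-- `Ψ` is surjective, even on `1 × Ẑ`. (toy bookkeeping) [cite: MochizukiEtTh2009, Def 2.1 p.36] -/
theorem Psi_surjective_right (y : Multiplicative (ZMod l)) : ∃ z : Zhat, Psi l (1, z) = y := by
  obtain ⟨z, hz⟩ := piL_surjective l y
  exact ⟨z, by simpa [Psi] using hz⟩

/-- `Φ` is continuous for the DISCRETE topology on the toy group (stated set-wise: preimages of arbitrary subsets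
are open). (toy bookkeeping) [cite: MochizukiEtTh2009, Def 2.1 p.36] -/
theorem isOpen_preimage_Phi (S : Set (heisPiC l)) : IsOpen (Phi l ⁻¹' S) := by
  have : Phi l ⁻¹' S = (fun x : PiCM l => piA l x.1) ⁻¹' {a | a.1 ∈ S} := rfl
  rw [this]
  exact (isOpen_discrete _).preimage ((piA l).continuous.comp continuous_fst)

/-- … and closed. (toy bookkeeping) [cite: MochizukiEtTh2009, Def 2.1 p.36] -/
theorem isClosed_preimage_Phi (S : Set (heisPiC l)) : IsClosed (Phi l ⁻¹' S) := by
  rw [← isOpen_compl_iff, ← Set.preimage_compl]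
  exact isOpen_preimage_Phi l _

/-- `Ker Ψ` is closed. (toy bookkeeping) [cite: MochizukiEtTh2009, Def 2.1 p.36] -/
theorem isClosed_ker_Psi : IsClosed ((Psi l).ker : Set (PiCM l)) := by
  have : ((Psi l).ker : Set (PiCM l)) = (fun x : PiCM l => piL l x.2) ⁻¹' {1} := by
    ext x; simp [Psi, MonoidHom.mem_ker]
  rw [this]
  exact (isClosed_discrete _).preimage ((piL l).continuous.comp continuous_snd)

/-- `Ker Ψ` is open. (toy bookkeeping) [cite: MochizukiEtTh2009, Def 2.1 p.36] -/
theorem isOpen_ker_Psi : IsOpen ((Psi l).ker : Set (PiCM l)) := by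
  have : ((Psi l).ker : Set (PiCM l)) = (fun x : PiCM l => piL l x.2) ⁻¹' {1} := by
    ext x; simp [Psi, MonoidHom.mem_ker]
  rw [this]
  exact (isOpen_discrete _).preimage ((piL l).continuous.comp continuous_snd)

/-- `Π_X := Φ⁻¹(heisPiX)` (index `2`). (toy bookkeeping) [cite: MochizukiEtTh2009, Def 2.1 p.36] -/
def PiXM : Subgroup (PiCM l) := (heisPiX l).comap (Phi l)

/-- `Δ̄_Θ`-preimage `:= Φ⁻¹(heisTheta)` (also `D_x`). (toy bookkeeping) [cite: MochizukiEtTh2009, Def 2.1 p.36] -/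
def barThetaM : Subgroup (PiCM l) := (heisTheta l).comap (Phi l)

/-- `Ker(Δ_X ↠ Δ̄_X) := Φ⁻¹(heisTheta) ∩ Ker Ψ`. (toy bookkeeping) [cite: MochizukiEtTh2009, Def 2.1 p.36] -/
def barKerM : Subgroup (PiCM l) := barThetaM l ⊓ (Psi l).ker


/-! ## 3. Toy facts pulled out of abc-iut-w5-d243's witness (same proofs, stated for bare elements) -/

omit [NeZero l] in
/-- In the toy, `Δ̄_Θ = heisTheta` commutes with `Π_X = heisPiX` on the nose. (toy bookkeeping)
[cite: MochizukiEtTh2009, Def 2.1 p.36] -/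
theorem heis_central (hl : Odd l) {t d : heisPiC l} (ht : t ∈ heisTheta l) (hd : d ∈ heisPiX l) :
    t * d * t⁻¹ * d⁻¹ = 1 :=
  Subgroup.mem_bot.mp ((heisenbergWitness l hl).barTheta_central t ht d ⟨hd, mem_ker_one l d⟩)

omit [NeZero l] in
/-- In the toy, an element outside `heisPiX` conjugates `d ∈ heisPiX` to `d⁻¹` modulo `heisTheta`. (toy bookkeeping)
[cite: MochizukiEtTh2009, Rmk 2.1.1 p.36] -/
theorem heis_inv_ell (hl : Odd l) {c d : heisPiC l} (hc : c ∉ heisPiX l) (hd : d ∈ heisPiX l) :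
    c * d * c⁻¹ * d ∈ heisTheta l :=
  (heisenbergWitness l hl).inv_ell c (mem_ker_one l c) hc d ⟨hd, mem_ker_one l d⟩

omit [NeZero l] in
/-- In the toy, an element outside `heisPiX` centralises `heisTheta`. (toy bookkeeping)
[cite: MochizukiEtTh2009, Prop 2.2 (i) p.37] -/
theorem heis_inv_theta (hl : Odd l) {c t : heisPiC l} (hc : c ∉ heisPiX l) (ht : t ∈ heisTheta l) :
    c * t * c⁻¹ * t⁻¹ = 1 :=
  Subgroup.mem_bot.mp ((heisenbergWitness l hl).inv_theta c (mem_ker_one l c) hc t ht)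

/-- In the abelian target of `Ψ`, commutators die. (toy bookkeeping) [cite: MochizukiEtTh2009, Def 2.1 p.36] -/
theorem Psi_comm_mem_ker (x y : PiCM l) : x * y * x⁻¹ * y⁻¹ ∈ (Psi l).ker := by
  rw [MonoidHom.mem_ker, map_mul, map_mul, map_mul, map_inv, map_inv, mul_inv_cancel_comm, mul_inv_cancel]

/-- `Ψ x ^ l = 1` (`#(ℤ/l) = l`). (toy bookkeeping) [cite: MochizukiEtTh2009, Def 2.1 p.36] -/
theorem Psi_pow_l (x : PiCM l) : Psi l x ^ l = 1 := by
  have h := pow_card_eq_one (G := Multiplicative (ZMod l)) (x := Psi l x)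
  rwa [Fintype.card_multiplicative, ZMod.card] at h

/-- `1 × Ẑ ⊆ Δ̄_Θ-preimage` (`Φ (1, z) = 1`). (toy bookkeeping) [cite: MochizukiEtTh2009, Def 2.1 p.36] -/
theorem one_prod_mem_barThetaM (z : Zhat) : ((1 : Ahat l), z) ∈ barThetaM l := by
  change Phi l (1, z) ∈ heisTheta l
  rw [Phi_apply, map_one]
  exact (heisTheta l).one_mem

/-- `Ψ` restricted to `Δ̄_Θ-preimage` is onto `ℤ/l` (this is `Δ̄_Θ ≅ ℤ/l` in the model: the Tate direction).
(toy bookkeeping) [cite: MochizukiEtTh2009, Def 2.1 p.36] -/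
theorem Psi_comp_barThetaM_surjective : Function.Surjective ((Psi l).comp (barThetaM l).subtype) := by
  intro y
  obtain ⟨z, hz⟩ := Psi_surjective_right l y
  exact ⟨⟨(1, z), one_prod_mem_barThetaM l z⟩, hz⟩

/-- `[Δ̄_Θ-preimage : Ker] = l`. (toy bookkeeping) [cite: MochizukiEtTh2009, Def 2.1 p.36] -/
theorem relIndex_barKerM : (barKerM l).relIndex (barThetaM l) = l := by
  rw [barKerM, Subgroup.inf_relIndex_left]
  have hker : ((Psi l).comp (barThetaM l).subtype).ker = (Psi l).ker.subgroupOf (barThetaM l) := by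
    ext x; rfl
  change ((Psi l).ker.subgroupOf (barThetaM l)).index = l
  rw [← hker, Subgroup.index_ker, MonoidHom.range_eq_top.mpr (Psi_comp_barThetaM_surjective l),
    Subgroup.card_top, Nat.card_eq_fintype_card, Fintype.card_multiplicative, ZMod.card]

omit [NeZero l] in
/-- Everything lies in the kernel of `Π_C → G_K = 1`. (toy bookkeeping) [cite: MochizukiEtTh2009, Def 2.1 p.36] -/
theorem mem_ker_oneM (x : PiCM l) : x ∈ (1 : PiCM l →* PUnit.{1}).ker := by
  rw [MonoidHom.mem_ker, MonoidHom.one_apply]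

/-- The `(a, b)`-coordinates `Δ_X ↠ (ℤ/l)²` of the model (the toy's `ellCoords` through `Φ`).
(toy bookkeeping) [cite: MochizukiEtTh2009, Def 2.1 p.36] -/
def ellCoordsM : ↥(PiXM l ⊓ (1 : PiCM l →* PUnit.{1}).ker) →* Multiplicative (ZMod l × ZMod l) :=
  (ellCoords.{0} l).comp
    (((Phi l).comp (PiXM l ⊓ (1 : PiCM l →* PUnit.{1}).ker).subtype).codRestrict _ fun g =>
      ⟨g.2.1, mem_ker_one l _⟩)

/-- They are onto. (toy bookkeeping) [cite: MochizukiEtTh2009, Def 2.1 p.36] -/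
theorem ellCoordsM_surjective : Function.Surjective (ellCoordsM l) := by
  intro y
  obtain ⟨⟨h, hh⟩, rfl⟩ := ellCoords_surjective l y
  obtain ⟨x, hx⟩ := Phi_surjective l h
  refine ⟨⟨x, ⟨show Phi l x ∈ heisPiX l by rw [hx]; exact hh.1, mem_ker_oneM l x⟩⟩, ?_⟩
  change ellCoords l ⟨Phi l x, _⟩ = ellCoords l ⟨h, hh⟩
  congr 1
  exact Subtype.ext hx

/-- Their kernel is `Δ̄_Θ-preimage`. (toy bookkeeping) [cite: MochizukiEtTh2009, Def 2.1 p.36] -/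
theorem ellCoordsM_ker : (ellCoordsM l).ker = (barThetaM l).subgroupOf _ := by
  ext g
  rw [MonoidHom.mem_ker, Subgroup.mem_subgroupOf]
  change ellCoords l ⟨Phi l g, _⟩ = 1 ↔ Phi l (g : PiCM l) ∈ heisTheta l
  rw [← MonoidHom.mem_ker, ellCoords_ker, Subgroup.mem_subgroupOf]

/-! ## 4. The profinite cover data `CoverDataAx` of the model -/

/-- **The model's `CoverDataAx`** (Def. 2.1, Rmk. 2.1.1, Prop. 2.2 (i) axioms): `Π_C := Â × Ẑ`, `G_K := 1`,
`Π_X := Φ⁻¹(heisPiX)`, `Δ̄_Θ-preimage := Φ⁻¹(heisTheta) =: D_x`, `Ker(Δ_X ↠ Δ̄_X) := Φ⁻¹(heisTheta) ∩ Ker Ψ`.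
Every axiom is the toy's, read through `Φ`, together with the commutativity of the Tate direction `Ψ`.
CONSISTENCY/TOY — not the profinite fundamental group of a curve. [cite: MochizukiEtTh2009, Def 2.1 p.36] -/
abbrev coverDataAx (hl : Odd l) : CoverDataAx.{0} l where
  l_odd := hl
  PiC := PiCM l
  GK := PUnit
  aug := 1
  PiX := PiXM l
  PiX_normal := by
    haveI : (heisPiX l).Normal := MonoidHom.normal_ker _
    exact Subgroup.Normal.comap inferInstance _
  index_PiX := by
    rw [PiXM, Subgroup.index_comap_of_surjective _ (Phi_surjective l), index_heisPiX]
  isOpen_PiX := by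
    change IsOpen ((Phi l) ⁻¹' (heisPiX l : Set (heisPiC l)))
    exact isOpen_preimage_Phi l _
  aug_PiX_surjective := fun _ => ⟨1, Subsingleton.elim _ _⟩
  barKer := barKerM l
  barKer_normal := by
    haveI : (barThetaM l).Normal := (heisTheta_normal l).comap _
    haveI : (Psi l).ker.Normal := MonoidHom.normal_ker _
    change (barThetaM l ⊓ (Psi l).ker).Normal
    infer_instance
  isClosed_barKer := by
    change IsClosed (((Phi l) ⁻¹' (heisTheta l : Set (heisPiC l))) ∩ ((Psi l).ker : Set (PiCM l)))
    exact (isClosed_preimage_Phi l _).inter (isClosed_ker_Psi l)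
  barTheta := barThetaM l
  barTheta_normal := (heisTheta_normal l).comap _
  barKer_le_barTheta := inf_le_left
  barTheta_le := by
    rw [MonoidHom.ker_one, inf_top_eq]
    exact Subgroup.comap_mono (heisTheta_le_heisPiX l)
  relIndex_barKer := relIndex_barKerM l
  ell_rank_two := by
    haveI : (barThetaM l).Normal := (heisTheta_normal l).comap _
    exact ⟨(QuotientGroup.quotientMulEquivOfEq (ellCoordsM_ker l).symm).trans
      (QuotientGroup.quotientKerEquivOfSurjective _ (ellCoordsM_surjective l))⟩
  barTheta_central := by
    intro t ht d hd
    rw [MonoidHom.ker_one, inf_top_eq] at hd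
    refine ⟨?_, Psi_comm_mem_ker l t d⟩
    change Phi l (t * d * t⁻¹ * d⁻¹) ∈ heisTheta l
    rw [map_mul, map_mul, map_mul, map_inv, map_inv, heis_central l hl ht hd]
    exact (heisTheta l).one_mem
  Dx := barThetaM l
  Dx_le := Subgroup.comap_mono (heisTheta_le_heisPiX l)
  aug_Dx_surjective := fun _ => ⟨1, Subsingleton.elim _ _⟩
  inertia_sup_barKer := by
    rw [MonoidHom.ker_one, inf_top_eq]
    exact sup_eq_left.mpr inf_le_left
  pow_mem_barKer := by
    intro d hd
    rw [MonoidHom.ker_one, inf_top_eq] at hd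
    refine ⟨?_, ?_⟩
    · change Phi l (d ^ l) ∈ heisTheta l
      rw [map_pow, pow_eq_one l hl hd]
      exact (heisTheta l).one_mem
    · show d ^ l ∈ (Psi l).ker
      rw [MonoidHom.mem_ker, map_pow, Psi_pow_l]
  inv_ell := by
    intro c _ hc d hd
    rw [MonoidHom.ker_one, inf_top_eq] at hd
    change Phi l (c * d * c⁻¹ * d) ∈ heisTheta l
    rw [map_mul, map_mul, map_mul, map_inv]
    exact heis_inv_ell l hl hc hd
  inv_theta := by
    intro c _ hc t ht
    refine ⟨?_, Psi_comm_mem_ker l c t⟩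
    change Phi l (c * t * c⁻¹ * t⁻¹) ∈ heisTheta l
    rw [map_mul, map_mul, map_mul, map_inv, map_inv, heis_inv_theta l hl hc ht]
    exact (heisTheta l).one_mem


/-! ## 5. The data of the orbicurve `C̲̲` (Def. 2.3) and of the tempered layer (Def. 2.5) — properties in parts 2–3 -/

/-- `Π_C̲ := Φ⁻¹(heisPiCu)` — the toy's `(ℤ/l × ℤ/l) ⋊ {1, s}` pulled back. (toy bookkeeping)
[cite: MochizukiEtTh2009, Def 2.1 p.36] -/
def HpM : Subgroup (PiCM l) := (heisPiCu l).comap (Phi l)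

omit [NeZero l] in
/-- The inversion `ι̲ := (η_A (s, 1), 1)` (`s = s r⁰` the reflection). (toy bookkeeping)
[cite: MochizukiEtTh2009, Prop 2.2 p.36] -/
def iotaM : PiCM l :=
  (etaCont (TA l) ((SemidirectProduct.inr (DihedralGroup.sr 0), 1) : heisPiC l × Multiplicative (ZMod 2)), 1)

/-- `E := (Π_C̲ ∩ Π_X) ∩ Ker Ψ` — the `(−1)`-eigenspace datum `Im(s_ι)` of Prop. 2.2 (i). (toy bookkeeping)
[cite: MochizukiEtTh2009, Prop 2.2 (i) p.37] -/
def EM : Subgroup (PiCM l) := (HpM l ⊓ PiXM l) ⊓ (Psi l).ker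

/-- `Π_C̲̲ := (S · E) · ⟨ι̲⟩` with the splitting `S := Ker(Δ_X ↠ Δ̄_X)` (Def. 2.3 / Prop. 2.2 (iii)). (toy bookkeeping)
[cite: MochizukiEtTh2009, Def 2.3 p.38] -/
def PiCuuM : Subgroup (PiCM l) := (barKerM l ⊔ EM l) ⊔ Subgroup.zpowers (iotaM l)


omit [NeZero l] in
/-- `A_X := heisPiX × ℤ/2 ⊆ A` (the `Π^tp_X`-part of the finite factor). (toy bookkeeping) [cite: MochizukiEtTh2009, Def 2.5 p.39] -/
def TAX : Subgroup (TA l) := (heisPiX l).comap (TA.heis l)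

end TemperedModel

end ThetaCovers

end Literature.AnabelianGeometry.EtaleTheta
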